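import Mathlib.AlgebraicGeometry.Morphisms.ClosedImmersion
import Mathlib.AlgebraicGeometry.Morphisms.QuasiCompact
import Mathlib.RingTheory.GradedAlgebra.Homogeneous.Ideal
import Summits.ResolutionOfSingularities.ResolutionOfSingularities.Theorems.WeightedInvariantDefs
import HarnessLib

/-!
# The rank-`0` graded atlas: the start of the cobordant-tower induction

Topic: `Summits/ResolutionOfSingularities/ResolutionOfSingularities/Theorems`. Stub
`stub_initialAtlas` of the line `Sketch` of the crux `Theses.WeightedInvariant.DatumToEmbedded`
(statement `stmt-ResolutionOfSingularities-0572`) of the summit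
`Summit.ResolutionOfSingularities.ResolutionOfSingularities`.

The proof of the crux carries a torus-quotient presentation `q : X ⟶ V` of the closed subscheme
`i : X ⟶ Y` (over `f : Y ⟶ Spec k`) through the cobordant tower, recorded as a
`GradedAtlas j f i q` (file `Theorems/WeightedInvariantDefs.lean`). This file provides the START
of that induction: rank `j = 0`, `V = X`, `q = 𝟙 X` — the trivial torus `𝔾ₘ⁰`.

Construction (`stub_initialAtlas`). The character group `Fin 0 → ℤ` of `𝔾ₘ⁰` is a one-point
type, so every chart ring `Γ(Y, W)` carries the **trivial grading** (`exists_gradedRing_top`: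
the whole ring in the only degree; every ideal is homogeneous).
Since `f` is quasi-compact over the affine `Spec k`, the space `Y` is compact and is covered by
finitely many affine opens `W a` (`isCompact_iff_finite_and_eq_biUnion_affineOpens`); the charts
of `V = X` are the `U a := i ⁻¹ᵁ (W a)`, affine because a closed immersion is an affine
morphism. The comparison map `(𝟙 X).appLE (U a) (U a) _` is the identity (`id_appLE_apply`),
so the degree-`0` sections descend (`c := i♯ s`), lift (surjectivity of `i♯` on affine opens for
a closed immersion, `Scheme.Hom.app_surjective`) and `q♯` is injective; the exponent is `1` and
the homogeneous unit of (the only) degree near every point is the section `1`.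

Only Mathlib and the `Defs` file are used.
-/

open CategoryTheory AlgebraicGeometry TopologicalSpace

set_option linter.dupNamespace false -- mandated namespace

namespace Summit.ResolutionOfSingularities.ResolutionOfSingularities.Theorems.DatumToEmbedded.InitialAtlas

/-! ## The trivial grading by a one-point monoid of degrees -/

section TrivialGrading

variable (R : Type*) [CommRing R] (M : Type*) [DecidableEq M] [AddMonoid M] [Subsingleton M]

/-- The **trivial grading** of a ring `R` by a one-point additive monoid `M` of degrees (the
character group of the trivial torus `𝔾ₘ⁰`): the whole ring sits in the only degree, the
decomposition of `r` is the single summand `r`, and every ideal is homogeneous (the only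
homogeneous component of `r` is `r` itself). [folklore] -/
theorem exists_gradedRing_top :
    ∃ _ : GradedRing (fun _ : M => (⊤ : AddSubgroup R)),
      ∀ I : Ideal R, I.IsHomogeneous (fun _ : M => (⊤ : AddSubgroup R)) := by
  refine ⟨{
    one_mem := AddSubgroup.mem_top _
    mul_mem := fun _ _ _ _ _ _ => AddSubgroup.mem_top _
    decompose' := fun r =>
      DirectSum.of (fun _ : M => ↥(⊤ : AddSubgroup R)) 0 ⟨r, AddSubgroup.mem_top r⟩
    left_inv := fun r => by simp [DirectSum.coeAddMonoidHom_of]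
    right_inv := fun x => ?_ }, fun I m r hr => ?_⟩
  · -- the single summand recovers every element of the direct sum
    dsimp only
    induction x using DirectSum.induction_on with
    | zero =>
      have h0 : (⟨(DirectSum.coeAddMonoidHom fun _ : M => (⊤ : AddSubgroup R)) 0,
          AddSubgroup.mem_top _⟩ : ↥(⊤ : AddSubgroup R)) = 0 := Subtype.ext (map_zero _)
      rw [h0, map_zero]
    | of m y =>
      obtain rfl : m = 0 := Subsingleton.elim _ _
      have h1 : (⟨(DirectSum.coeAddMonoidHom fun _ : M => (⊤ : AddSubgroup R))
          (DirectSum.of (fun _ : M => ↥(⊤ : AddSubgroup R)) 0 y), AddSubgroup.mem_top _⟩ :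
          ↥(⊤ : AddSubgroup R)) = y := Subtype.ext (DirectSum.coeAddMonoidHom_of _ _ _)
      rw [h1]
    | add x y hx hy =>
      have h2 : (⟨(DirectSum.coeAddMonoidHom fun _ : M => (⊤ : AddSubgroup R)) (x + y),
          AddSubgroup.mem_top _⟩ : ↥(⊤ : AddSubgroup R)) =
          ⟨(DirectSum.coeAddMonoidHom fun _ : M => (⊤ : AddSubgroup R)) x, AddSubgroup.mem_top _⟩ +
          ⟨(DirectSum.coeAddMonoidHom fun _ : M => (⊤ : AddSubgroup R)) y, AddSubgroup.mem_top _⟩ :=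
        Subtype.ext (map_add _ _ _)
      rw [h2, map_add, hx, hy]
  · -- every ideal is homogeneous
    obtain rfl : m = 0 := Subsingleton.elim _ _
    change ((DirectSum.of (fun _ : M => ↥(⊤ : AddSubgroup R)) 0
      ⟨r, AddSubgroup.mem_top r⟩ 0 : ↥(⊤ : AddSubgroup R)) : R) ∈ I
    rw [DirectSum.of_eq_same]
    exact hr

end TrivialGrading

/-! ## The identity's comparison maps -/

-- adapted from `Literature/AlgebraicGeometry/Motives/BlochSrinivasPrincipleFiniteCoverLimitProofs`
/-- `(𝟙 X).appLE U U` is the identity on sections. [folklore] -/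
theorem id_appLE_apply {X : Scheme.{0}} (U : X.Opens) (e : U ≤ (𝟙 X : X ⟶ X) ⁻¹ᵁ U)
    (x : Γ(X, U)) : (𝟙 X : X ⟶ X).appLE U U e x = x := by
  have h : (𝟙 X : X ⟶ X).appLE U U e = 𝟙 _ := by
    rw [show (𝟙 X : X ⟶ X).appLE U U e = (𝟙 X : X ⟶ X).appLE U ((𝟙 X : X ⟶ X) ⁻¹ᵁ U) le_rfl
      from rfl, Scheme.Hom.appLE_eq_app, Scheme.Hom.id_app]
  rw [h, CommRingCat.id_apply]

/-! ## The rank-`0` atlas -/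

/-- **The initial graded atlas** (rank `0`, start of the cobordant-tower induction): every closed
immersion `i : X ⟶ Y` into a scheme `Y` quasi-compact over a field carries a graded atlas of
rank `0` for the trivial presentation `q = 𝟙 X` — finitely many affine charts `W a ⊆ Y` covering
`Y`, quotient charts `U a := X ∩ W a`, the trivial grading of `Γ(Y, W a)` by the one-point
character group `Fin 0 → ℤ`, exponent `1` and the unit section `1`. [folklore] -/
theorem stub_initialAtlas :
    ∀ {k : Type} [Field k] {Y X : Scheme.{0}} (f : Y ⟶ Spec (.of k)) [QuasiCompact f]
      (i : X ⟶ Y) [IsClosedImmersion i], Nonempty (GradedAtlas 0 f i (𝟙 X)) := by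
  intro k _ Y X f _ i _
  -- `Y` is compact: finitely many affine opens cover it
  haveI : CompactSpace Y := QuasiCompact.compactSpace_of_compactSpace f
  obtain ⟨S, hS, hS'⟩ := (isCompact_iff_finite_and_eq_biUnion_affineOpens
    (U := (⊤ : Y.Opens))).mp (isCompact_univ_iff.mpr ‹CompactSpace Y›)
  haveI : Finite S := hS.to_subtype
  have hcov : ⨆ a : S, ((a : Y.affineOpens) : Y.Opens) = ⊤ := by
    rw [iSup_subtype'', ← hS']
  -- the trivial gradings of the chart rings
  choose g hg using fun a : S =>
    exists_gradedRing_top Γ(Y, ((a : Y.affineOpens) : Y.Opens)) (Fin 0 → ℤ)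
  refine ⟨{
    ι := S
    finite_ι := inferInstance
    U := fun a => ⟨i ⁻¹ᵁ ((a : Y.affineOpens) : Y.Opens), (a : Y.affineOpens).2.preimage i⟩
    iSup_eq_top := i.iSup_preimage_eq_top hcov
    W := fun a => (a : Y.affineOpens)
    preimage_eq := fun a => rfl
    piece := fun a _ => ⊤
    gradedRing := g
    appLE_mem := fun a c => AddSubgroup.mem_top _
    isHomogeneous_ker := fun a => hg a _
    exists_preimage := fun a s _ => ⟨i.app _ s, id_appLE_apply _ _ _⟩
    exists_lift := fun a c => ?_
    appLE_injective := fun a c c' h => by rwa [id_appLE_apply, id_appLE_apply] at h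
    exponent := 1
    exponent_pos := Nat.one_pos
    exists_unit := fun x => ?_ }⟩
  · -- surjectivity of `i♯` on the affine chart
    obtain ⟨s, hs⟩ := i.app_surjective _ (a : Y.affineOpens).2 c
    exact ⟨s, AddSubgroup.mem_top _, by rw [id_appLE_apply, hs]⟩
  · -- the unit section `1` on a chart through `i x`
    have hx : i x ∈ (⊤ : Y.Opens) := trivial
    rw [← hcov, Opens.mem_iSup] at hx
    obtain ⟨a, ha⟩ := hx
    exact ⟨a, ha, fun χ => ⟨1, AddSubgroup.mem_top _, by rw [map_one]; exact isUnit_one⟩⟩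

end Summit.ResolutionOfSingularities.ResolutionOfSingularities.Theorems.DatumToEmbedded.InitialAtlas
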